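import Literature.NumberTheory.QuadraticForms.QuadraticNormIndex
import Literature.NumberTheory.QuadraticForms.HilbertSymbolBilinear
import Literature.NumberTheory.QuadraticForms.HilbertReciprocityFiniteness
import Literature.NumberTheory.QuadraticForms.HilbertSymbolArchimedean
import HarnessLib

/-!
# Local Hilbert symbols and local norms at all places of a number field, uniformly

Topic `NumberTheory/QuadraticForms`; namespace `Literature.NumberTheory.QuadraticForms`. Mathlib
has no single type of places of a number field `K`; the files of this directory state everything
twice, for the finite places `v : HeightOneSpectrum (𝓞 K)` (completion `v.adicCompletion K`) and
for the infinite places `w : InfinitePlace K` (completion `w.Completion`). For arguments that run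
over *all* places at once — the support `{𝔭 : (a, b)_𝔭 = -1}` of the product in Hilbert's
reciprocity law (O'Meara 71:18) and the bookkeeping of local norms of idèles (O'Meara §65A) — this
file packages both kinds into the sum type `HeightOneSpectrum (𝓞 K) ⊕ InfinitePlace K`:

* `placeSymbol a b 𝔭 : ℤ` — the local Hilbert symbol `(a, b)_𝔭` at the place `𝔭` (O'Meara §63B,
  §71), with `placeSymbol_mul_left` : **multiplicativity in the first variable at every place**
  (finite places: the local norm index `2`, `hilbertSymbol_adicCompletion_mul_left`,
  `HilbertSymbolBilinear.lean`; infinite places: `hilbertSymbol_completion_mul_left`, proved here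
  from the sign description of the real symbol, `HilbertSymbolArchimedean.lean`);
* `badPlaces a b` — the finite set `Bad(a) = {𝔭 : (a, b)_𝔭 = -1}` (`badPlaces_finite`,
  `ncard_badPlaces` = number of finite plus number of infinite exceptional places, and
  `badPlaces_mul` : `Bad(x y) = Bad(x) ∆ Bad(y)`);
* `IsLocalNormAt b i 𝔭` — the idèle `i` is a local norm from `K_𝔭(√b)` at `𝔭` (its component lies
  in `quadraticNormSubgroup K_𝔭 b`, `QuadraticNormIndex.lean`), with
  `mem_normIdeles_iff_forall_isLocalNormAt` (O'Meara Example 65:2),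
  `isLocalNormAt_principal_iff` : `(γ)` is a local norm at `𝔭` iff `(γ, b)_𝔭 = 1` (O'Meara §65A),
  and `exists_placeSymbol_eq_neg_one_iff_of_mem_sup` : for `i = (γ) n ∈ P_K · N_{E/K} J_E` the
  places where `i` is not a local norm are those where `(γ, b)_𝔭 = -1`.

Used in `HilbertReciprocityReduction.lean` (O'Meara 71:18, step 1) and `HilbertReciprocityProofs.lean`.

## References

* O. T. O'Meara, *Introduction to quadratic forms*, Grundlehren 117, Springer (1963), §63B (the
  symbol over `ℝ`, `ℂ` and local fields), §65A (local norms of idèles, Example 65:2), §71.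
-/

noncomputable section

open NumberField IsDedekindDomain

namespace Literature.NumberTheory.QuadraticForms

variable (K : Type) [Field K] [NumberField K]

/-! ### The symbol at a real place is multiplicative in the first variable -/

section Infinite

variable {K}

omit [NumberField K] in
/-- At a real place `w` where `σ_w(b) < 0`: `(z, b)_w = -1` iff `σ_w(z) < 0`, for `z ≠ 0`
(`hilbertSymbol_completion_eq_neg_one_iff_of_isReal`). [folklore] -/
theorem hilbertSymbol_completion_eq_neg_one_iff_of_embedding_neg {w : InfinitePlace K}
    (hw : w.IsReal) {z b : K} (hz : z ≠ 0) (hb : InfinitePlace.embedding_of_isReal hw b < 0) :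
    hilbertSymbol w.Completion (algebraMap K _ z) (algebraMap K _ b) = -1 ↔
      InfinitePlace.embedding_of_isReal hw z < 0 := by
  rw [hilbertSymbol_completion_eq_neg_one_iff_of_isReal hw]
  have hz' : InfinitePlace.embedding_of_isReal hw z ≠ 0 := (_root_.map_ne_zero _).2 hz
  constructor
  · rintro ⟨h1, -⟩
    exact lt_of_le_of_ne h1 hz'
  · intro h
    exact ⟨h.le, hb.le⟩

omit [NumberField K] in
/-- **The Hilbert symbol at an infinite place is multiplicative in the first variable**:
`(x y, b)_w = (x, b)_w (y, b)_w` for `x y b ∈ Kˣ`. At a complex place all symbols are `1`; at a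
real place with `σ_w(b) > 0` as well; at a real place with `σ_w(b) < 0`, `(z, b)_w` is the sign of
`σ_w(z)`. (O'Meara §63B, the symbol over `ℝ` and `ℂ`.) [folklore] -/
theorem hilbertSymbol_completion_mul_left (w : InfinitePlace K) {x y b : K} (hx : x ≠ 0)
    (hy : y ≠ 0) (hb : b ≠ 0) :
    hilbertSymbol w.Completion (algebraMap K _ (x * y)) (algebraMap K _ b) =
      hilbertSymbol w.Completion (algebraMap K _ x) (algebraMap K _ b) *
        hilbertSymbol w.Completion (algebraMap K _ y) (algebraMap K _ b) := by
  rcases w.isReal_or_isComplex with hw | hw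
  · set σ := InfinitePlace.embedding_of_isReal hw with hσ
    have hb0 : σ b ≠ 0 := (_root_.map_ne_zero _).2 hb
    rcases lt_or_gt_of_ne hb0 with hbn | hbp
    · -- `σ b < 0`: the symbol is the sign of the first variable
      have key : ∀ {z : K}, z ≠ 0 →
          hilbertSymbol w.Completion (algebraMap K _ z) (algebraMap K _ b) =
            if σ z < 0 then -1 else 1 := by
        intro z hz
        split_ifs with h
        · exact (hilbertSymbol_completion_eq_neg_one_iff_of_embedding_neg hw hz hbn).2 h
        · exact (hilbertSymbol_ne_neg_one_iff _ _).1 fun h' ↦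
            h ((hilbertSymbol_completion_eq_neg_one_iff_of_embedding_neg hw hz hbn).1 h')
      rw [key (mul_ne_zero hx hy), key hx, key hy, map_mul]
      have hx0 : σ x ≠ 0 := (_root_.map_ne_zero _).2 hx
      have hy0 : σ y ≠ 0 := (_root_.map_ne_zero _).2 hy
      rcases lt_or_gt_of_ne hx0 with hxn | hxp <;> rcases lt_or_gt_of_ne hy0 with hyn | hyp
      · rw [if_neg (not_lt.2 (mul_pos_of_neg_of_neg hxn hyn).le), if_pos hxn, if_pos hyn]
        norm_num
      · rw [if_pos (mul_neg_of_neg_of_pos hxn hyp), if_pos hxn, if_neg (not_lt.2 hyp.le)]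
        norm_num
      · rw [if_pos (mul_neg_of_pos_of_neg hxp hyn), if_neg (not_lt.2 hxp.le), if_pos hyn]
        norm_num
      · rw [if_neg (not_lt.2 (mul_pos hxp hyp).le), if_neg (not_lt.2 hxp.le),
          if_neg (not_lt.2 hyp.le)]
        norm_num
    · -- `σ b > 0`: all symbols are `1`
      have key : ∀ z : K,
          hilbertSymbol w.Completion (algebraMap K _ z) (algebraMap K _ b) = 1 := fun z ↦
        (hilbertSymbol_completion_eq_one_iff_of_isReal hw z b).2 (Or.inr hbp)
      rw [key, key, key, mul_one]
  · rw [hilbertSymbol_completion_eq_one_of_isComplex hw (Or.inr hb),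
      hilbertSymbol_completion_eq_one_of_isComplex hw (Or.inr hb),
      hilbertSymbol_completion_eq_one_of_isComplex hw (Or.inr hb), mul_one]

end Infinite

/-! ### Places, local symbols and local norms, uniformly in finite and infinite places -/

section Places

variable {K}

/-- The **local Hilbert symbol `(a, b)_𝔭` at a place `𝔭`** of the number field `K`, finite
(`𝔭 = inl v`, symbol in `K_v = v.adicCompletion K`) or infinite (`𝔭 = inr w`, symbol in
`K_w = w.Completion`) — Mathlib has no single type of places, so a place is an element of
`HeightOneSpectrum (𝓞 K) ⊕ InfinitePlace K`. (O'Meara §63B, §71: `(α, β / 𝔭)` for `𝔭 ∈ Ω`.)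
[folklore] -/
def placeSymbol (a b : K) : HeightOneSpectrum (𝓞 K) ⊕ InfinitePlace K → ℤ :=
  Sum.elim (fun v ↦ hilbertSymbol (v.adicCompletion K) (algebraMap K _ a) (algebraMap K _ b))
    (fun w ↦ hilbertSymbol w.Completion (algebraMap K _ a) (algebraMap K _ b))

/-- `placeSymbol a b (inl v) = (a, b)_v` (definitional). [folklore] -/
@[simp] theorem placeSymbol_inl (a b : K) (v : HeightOneSpectrum (𝓞 K)) :
    placeSymbol a b (Sum.inl v) =
      hilbertSymbol (v.adicCompletion K) (algebraMap K _ a) (algebraMap K _ b) := rfl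

/-- `placeSymbol a b (inr w) = (a, b)_w` (definitional). [folklore] -/
@[simp] theorem placeSymbol_inr (a b : K) (w : InfinitePlace K) :
    placeSymbol a b (Sum.inr w) = hilbertSymbol w.Completion (algebraMap K _ a) (algebraMap K _ b) :=
  rfl

/-- The local symbol is `1` or `-1`. [folklore] -/
theorem placeSymbol_eq_one_or_eq_neg_one (a b : K) (p : HeightOneSpectrum (𝓞 K) ⊕ InfinitePlace K) :
    placeSymbol a b p = 1 ∨ placeSymbol a b p = -1 := by
  cases p with
  | inl v => exact hilbertSymbol_eq_one_or_eq_neg_one _ _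
  | inr w => exact hilbertSymbol_eq_one_or_eq_neg_one _ _

/-- `placeSymbol a b p ≠ 1 ↔ placeSymbol a b p = -1`. [folklore] -/
theorem placeSymbol_ne_one_iff (a b : K) (p : HeightOneSpectrum (𝓞 K) ⊕ InfinitePlace K) :
    placeSymbol a b p ≠ 1 ↔ placeSymbol a b p = -1 := by
  rcases placeSymbol_eq_one_or_eq_neg_one a b p with h | h <;> simp [h]

/-- **Multiplicativity in the first variable at every place**: `(x y, b)_𝔭 = (x, b)_𝔭 (y, b)_𝔭`
for `x y b ∈ Kˣ` (finite places: `hilbertSymbol_adicCompletion_mul_left`, the local norm index `2`;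
infinite places: `hilbertSymbol_completion_mul_left`). [folklore] -/
theorem placeSymbol_mul_left {x y b : K} (hx : x ≠ 0) (hy : y ≠ 0) (hb : b ≠ 0)
    (p : HeightOneSpectrum (𝓞 K) ⊕ InfinitePlace K) :
    placeSymbol (x * y) b p = placeSymbol x b p * placeSymbol y b p := by
  cases p with
  | inl v =>
    simp only [placeSymbol_inl, map_mul]
    exact hilbertSymbol_adicCompletion_mul_left K v ((map_ne_zero _).2 hx) ((map_ne_zero _).2 hy)
      ((map_ne_zero _).2 hb)
  | inr w =>
    simp only [placeSymbol_inr]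
    exact hilbertSymbol_completion_mul_left w hx hy hb

/-- The set `Bad(a) = {𝔭 : (a, b)_𝔭 = -1}` of places of `K` (finite and infinite) where the Hilbert
symbol of `a` and `b` is `-1` — the support of the product `∏_𝔭 (a, b)_𝔭` of Hilbert reciprocity.
[folklore] -/
def badPlaces (a b : K) : Set (HeightOneSpectrum (𝓞 K) ⊕ InfinitePlace K) :=
  {p | placeSymbol a b p = -1}

/-- Membership in `badPlaces a b` (definitional). [folklore] -/
@[simp] theorem mem_badPlaces_iff {a b : K} {p : HeightOneSpectrum (𝓞 K) ⊕ InfinitePlace K} :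
    p ∈ badPlaces a b ↔ placeSymbol a b p = -1 := Iff.rfl

/-- The finite-place and infinite-place parts of `badPlaces a b`. [folklore] -/
theorem preimage_inl_badPlaces (a b : K) :
    Sum.inl ⁻¹' badPlaces a b = {v : HeightOneSpectrum (𝓞 K) |
      hilbertSymbol (v.adicCompletion K) (algebraMap K _ a) (algebraMap K _ b) = -1} := rfl

/-- The infinite-place part of `badPlaces a b`. [folklore] -/
theorem preimage_inr_badPlaces (a b : K) :
    Sum.inr ⁻¹' badPlaces a b = {w : InfinitePlace K |
      hilbertSymbol w.Completion (algebraMap K _ a) (algebraMap K _ b) = -1} := rfl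

/-- `Bad(a)` is finite for `a b ≠ 0` (finitely many finite places, O'Meara 71:18 first assertion,
`finite_setOf_hilbertSymbol_eq_neg_one`; finitely many infinite places). [folklore] -/
theorem badPlaces_finite {a b : K} (ha : a ≠ 0) (hb : b ≠ 0) : (badPlaces a b).Finite := by
  rw [← Set.image_preimage_inl_union_image_preimage_inr (badPlaces a b)]
  exact ((finite_setOf_hilbertSymbol_eq_neg_one K ha hb).image _).union
    ((Set.toFinite _).image _)

/-- `|Bad(a)|` is the number of finite places plus the number of infinite places with symbol `-1`.
[folklore] -/
theorem ncard_badPlaces {a b : K} (ha : a ≠ 0) (hb : b ≠ 0) :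
    (badPlaces a b).ncard =
      {v : HeightOneSpectrum (𝓞 K) |
          hilbertSymbol (v.adicCompletion K) (algebraMap K _ a) (algebraMap K _ b) = -1}.ncard +
        {w : InfinitePlace K |
          hilbertSymbol w.Completion (algebraMap K _ a) (algebraMap K _ b) = -1}.ncard := by
  obtain ⟨h1, h2⟩ := Set.finite_preimage_inl_and_inr.2 (badPlaces_finite ha hb)
  rw [← preimage_inl_badPlaces, ← preimage_inr_badPlaces,
    ← Set.ncard_image_of_injective (Sum.inl ⁻¹' badPlaces a b) Sum.inl_injective,
    ← Set.ncard_image_of_injective (Sum.inr ⁻¹' badPlaces a b) Sum.inr_injective,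
    ← Set.ncard_union_eq Set.disjoint_image_inl_image_inr (h1.image _) (h2.image _),
    Set.image_preimage_inl_union_image_preimage_inr]

/-- **`Bad(x y) = Bad(x) ∆ Bad(y)`** (multiplicativity of the local symbols, values `±1`).
[folklore] -/
theorem badPlaces_mul {x y b : K} (hx : x ≠ 0) (hy : y ≠ 0) (hb : b ≠ 0) :
    badPlaces (x * y) b = symmDiff (badPlaces x b) (badPlaces y b) := by
  ext p
  rw [Set.mem_symmDiff, mem_badPlaces_iff, mem_badPlaces_iff, mem_badPlaces_iff,
    placeSymbol_mul_left hx hy hb]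
  rcases placeSymbol_eq_one_or_eq_neg_one x b p with h1 | h1 <;>
    rcases placeSymbol_eq_one_or_eq_neg_one y b p with h2 | h2 <;>
    simp [h1, h2]

/-- The idèle `i` **is a local norm at the place `𝔭`** from `K_𝔭(√b)`: its `𝔭`-component lies in
the local norm group `quadraticNormSubgroup K_𝔭 b` (O'Meara §65A). [folklore] -/
def IsLocalNormAt (b : K) (i : GaloisRepresentations.ideleGroup K) :
    HeightOneSpectrum (𝓞 K) ⊕ InfinitePlace K → Prop :=
  Sum.elim
    (fun v ↦ ideleFiniteComponent K v i ∈
      quadraticNormSubgroup (v.adicCompletion K) (algebraMap K _ b))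
    (fun w ↦ ideleInfiniteComponent K w i ∈ quadraticNormSubgroup w.Completion (algebraMap K _ b))

/-- `IsLocalNormAt b i (inl v)` unfolded. [folklore] -/
@[simp] theorem isLocalNormAt_inl (b : K) (i : GaloisRepresentations.ideleGroup K)
    (v : HeightOneSpectrum (𝓞 K)) :
    IsLocalNormAt b i (Sum.inl v) ↔ ideleFiniteComponent K v i ∈
      quadraticNormSubgroup (v.adicCompletion K) (algebraMap K _ b) := Iff.rfl

/-- `IsLocalNormAt b i (inr w)` unfolded. [folklore] -/
@[simp] theorem isLocalNormAt_inr (b : K) (i : GaloisRepresentations.ideleGroup K) (w : InfinitePlace K) :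
    IsLocalNormAt b i (Sum.inr w) ↔ ideleInfiniteComponent K w i ∈
      quadraticNormSubgroup w.Completion (algebraMap K _ b) := Iff.rfl

/-- Norm idèles are the idèles that are local norms at every place (O'Meara Example 65:2;
`mem_normIdeles_iff`). [folklore] -/
theorem mem_normIdeles_iff_forall_isLocalNormAt {b : K} {i : GaloisRepresentations.ideleGroup K} :
    i ∈ normIdeles K b ↔ ∀ p, IsLocalNormAt b i p := by
  rw [mem_normIdeles_iff]
  constructor
  · rintro ⟨h1, h2⟩ p
    cases p with
    | inl v => exact h1 v
    | inr w => exact h2 w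
  · intro h
    exact ⟨fun v ↦ h (Sum.inl v), fun w ↦ h (Sum.inr w)⟩

/-- Multiplying by an idèle that is a local norm at `𝔭` does not change being a local norm at `𝔭`.
[folklore] -/
theorem isLocalNormAt_mul_iff_of_isLocalNormAt {b : K} {i j : GaloisRepresentations.ideleGroup K}
    {p : HeightOneSpectrum (𝓞 K) ⊕ InfinitePlace K} (hj : IsLocalNormAt b j p) :
    IsLocalNormAt b (i * j) p ↔ IsLocalNormAt b i p := by
  cases p with
  | inl v =>
    rw [isLocalNormAt_inl, map_mul]
    exact Subgroup.mul_mem_cancel_right _ hj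
  | inr w =>
    rw [isLocalNormAt_inr, map_mul]
    exact Subgroup.mul_mem_cancel_right _ hj

/-- The same on the left. [folklore] -/
theorem isLocalNormAt_mul_iff_of_isLocalNormAt_left {b : K} {i j : GaloisRepresentations.ideleGroup K}
    {p : HeightOneSpectrum (𝓞 K) ⊕ InfinitePlace K} (hi : IsLocalNormAt b i p) :
    IsLocalNormAt b (i * j) p ↔ IsLocalNormAt b j p := by
  rw [mul_comm]
  exact isLocalNormAt_mul_iff_of_isLocalNormAt hi

/-- **Principal idèles**: `(γ)` is a local norm at `𝔭` iff `(γ, b)_𝔭 = 1` (O'Meara §65A: "`α` is a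
local norm at `𝔭` iff `(α, θ / 𝔭) = 1`"; `hilbertSymbol_eq_one_iff_mem_quadraticNormSubgroup`).
[cite: Omeara1963, §65A (before Example 65:1)] -/
theorem isLocalNormAt_principal_iff {b : K} (hb : b ≠ 0) (γ : Kˣ)
    (p : HeightOneSpectrum (𝓞 K) ⊕ InfinitePlace K) :
    IsLocalNormAt b (Units.map (algebraMap K (AdeleRing (𝓞 K) K) : K →* _) γ) p ↔
      placeSymbol (γ : K) b p = 1 := by
  cases p with
  | inl v =>
    haveI : CharZero (v.adicCompletion K) :=
      charZero_of_injective_algebraMap (algebraMap K _).injective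
    rw [isLocalNormAt_inl, ideleFiniteComponent_principal, placeSymbol_inl,
      ← hilbertSymbol_eq_one_iff_mem_quadraticNormSubgroup
        ((map_ne_zero (algebraMap K (v.adicCompletion K))).2 hb)]
    rfl
  | inr w =>
    haveI : CharZero w.Completion := charZero_of_injective_algebraMap (algebraMap K _).injective
    rw [isLocalNormAt_inr, ideleInfiniteComponent_principal, placeSymbol_inr,
      ← hilbertSymbol_eq_one_iff_mem_quadraticNormSubgroup
        ((map_ne_zero (algebraMap K w.Completion)).2 hb)]
    rfl

/-- **Reading a field element off `P_K · N_{E/K} J_E`**: if `i = (γ) n` with `n` a norm idèle, then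
the places where `i` is not a local norm are exactly the places where `(γ, b)_𝔭 = -1`.
[cite: Omeara1963, §71D proof of Thm. 71:18 (step 1)] -/
theorem exists_placeSymbol_eq_neg_one_iff_of_mem_sup {b : K} (hb : b ≠ 0)
    {i : GaloisRepresentations.ideleGroup K}
    (hi : i ∈ GaloisRepresentations.principalIdeles K ⊔ normIdeles K b) :
    ∃ γ : Kˣ, ∀ p, placeSymbol (γ : K) b p = -1 ↔ ¬ IsLocalNormAt b i p := by
  obtain ⟨q, hq, n, hn, rfl⟩ := Subgroup.mem_sup.1 hi
  obtain ⟨γ, rfl⟩ := MonoidHom.mem_range.1 hq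
  refine ⟨γ, fun p ↦ ?_⟩
  rw [isLocalNormAt_mul_iff_of_isLocalNormAt (mem_normIdeles_iff_forall_isLocalNormAt.1 hn p),
    isLocalNormAt_principal_iff hb, ← placeSymbol_ne_one_iff]

end Places

end Literature.NumberTheory.QuadraticForms
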